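import Literature.Probability.LatticeModels.PlaneRotatorLiebBoxCriterion
import Literature.Probability.Percolation.SiteConnectionTools
import Literature.Barriers.CriticalPhenomena.LongRangeTrivialityOnZ3MMSWalk
import HarnessLib

/-!
# Relabelling invariance of plane-rotator two-point functions; hyperoctahedral symmetry of the free box

J. Ginibre, *General formulation of Griffiths' inequalities*, Comm. Math. Phys. **16** (1970) 310–328 [Ginibre1970],
Example 4 (plane rotators `cos(m·φ)` on a product of circles: the model is defined by the coupling array alone, so a
relabelling of the sites carrying the couplings along carries the Gibbs state along); E. H. Lieb, Comm. Math. Phys.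
**77** (1980) 127 [Lieb1980], p. 128 (the box `B` = boundary of `[−R, R]^ν` as separating set — a set invariant
under the symmetries of `ℤ^ν` fixing the origin). In the vocabulary of `PlaneRotatorGinibreComparison.lean`
(`twoPoint J a b = ⟨cos(θ_a − θ_b)⟩_{V,J}`, couplings on ordered pairs):

* `twoPoint_comp_equiv` — **relabelling**: for a bijection `e : S ≃ V`,
  `⟨cos(θ_a − θ_b)⟩_{S, J ∘ (e × e)} = ⟨cos(θ_{e a} − θ_{e b})⟩_{V, J}` (the tree's restriction identity
  `twoPoint_extend_eq` at a bijection).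
* `boxSignedPerm π ε R` — the signed coordinate permutation `x ↦ (i ↦ ε_i x_{π⁻¹ i})` (tree `Site.signedPerm`) as a
  bijection of the box `box ν R = [−R, R]^ν` (tree `signedPerm_mem_box_iff`); it fixes the centre and preserves the
  nearest-neighbour couplings (`l1Norm_signedPerm_sub`).
* `twoPoint_nnXY_box_signedPerm` — **hyperoctahedral symmetry of the free box**: the two-point function of the
  nearest-neighbour XY model on `box ν R` with free boundary conditions (`nnXYCoupling K ν (box ν R)`) is invariant
  under every signed coordinate permutation; in particular `⟨cos(θ_0 − θ_{σx})⟩ = ⟨cos(θ_0 − θ_x)⟩`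
  (`twoPoint_nnXY_box_refCentre_signedPerm`), with the coordinate reflections and coordinate permutations spelled out
  (`twoPoint_nnXY_box_refCentre_reflect`, `twoPoint_nnXY_box_refCentre_perm`).

Cell use (`pub/hubbard-tc`, MO-S3, K5-Lieb column): Lieb's box number of the two-dimensional model reduces to
two-point functions `⟨cos(θ_0 − θ_x)⟩` of the free `(2R−1) × (2R−1)` block (`PlaneRotatorBoxBlockReduction.lean`);
by this symmetry only one representative per hyperoctahedral orbit of `x` has to be enclosed — for the `3 × 3` block
the two numbers `G_e = ⟨cos(θ_0 − θ_{(1,0)})⟩`, `G_c = ⟨cos(θ_0 − θ_{(1,1)})⟩` (`S_2 = u(K)(4G_e + 8G_c)`).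
Classical model only; no numerics here.
-/

noncomputable section

open MeasureTheory Finset
open scoped BigOperators

namespace Literature.Probability.LatticeModels

namespace PlaneRotator

/-! ### Relabelling invariance -/

section Relabel

variable {S V : Type*} [Fintype S] [Fintype V] [MeasurableSpace Circle] [BorelSpace Circle]

/-- **Relabelling invariance of the two-point function.** For a bijection `e : S ≃ V` and couplings `J` on `V`,
the model on `S` with the pulled-back couplings `J(e·, e·)` has `⟨cos(θ_a − θ_b)⟩_S = ⟨cos(θ_{ea} − θ_{eb})⟩_V`
(the zero extension along a bijection is the pull-back; tree `twoPoint_extend_eq`).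
[cite: Ginibre1970, Example 4 (plane rotators)] -/
theorem twoPoint_comp_equiv (e : S ≃ V) (J : V × V → ℝ) (a b : S) :
    twoPoint (fun q : S × S => J (e q.1, e q.2)) a b = twoPoint J (e a) (e b) := by
  classical
  rw [← twoPoint_extend_eq e.injective (fun q : S × S => J (e q.1, e q.2)) a b]
  congr 1
  funext p
  have hp : p = Prod.map e e (e.symm p.1, e.symm p.2) := by simp
  unfold extendCoupling
  rw [hp, (e.injective.prodMap e.injective).extend_apply]
  simp

end Relabel

/-! ### Signed coordinate permutations of the box -/

section SignedPerm

open Literature.Barriers.CriticalPhenomena Literature.Barriers.CriticalPhenomena.LongRangeIsing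
open Literature.Probability.Percolation (signedPerm_mem_box_iff)

variable {ν : ℕ}

/-- A **signed coordinate permutation of the box** `[−R, R]^ν`: `x ↦ (i ↦ ε_i x_{π⁻¹ i})` (tree `Site.signedPerm`,
which preserves the box, `signedPerm_mem_box_iff`). [cite: Lieb1980, p. 128 (the box and its boundary B)] -/
def boxSignedPerm (π : Equiv.Perm (Fin ν)) (ε : Fin ν → ℤˣ) (R : ℕ) : box ν R ≃ box ν R where
  toFun x := ⟨Site.signedPerm π ε (x : Site ν), (signedPerm_mem_box_iff π ε).2 x.2⟩
  invFun y := ⟨(Site.signedPerm π ε).symm (y : Site ν), by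
    have h := signedPerm_mem_box_iff π ε (n := R) (x := (Site.signedPerm π ε).symm (y : Site ν))
    rw [Equiv.apply_symm_apply] at h
    exact h.1 y.2⟩
  left_inv x := Subtype.ext (Equiv.symm_apply_apply _ _)
  right_inv y := Subtype.ext (Equiv.apply_symm_apply _ _)

omit ν in
/-- Coordinates of the image: `(σx)_i = ε_i x_{π⁻¹ i}`. [cite: Lieb1980, p. 128 (the box and its boundary B)] -/
@[simp] theorem boxSignedPerm_apply_coe {ν : ℕ} (π : Equiv.Perm (Fin ν)) (ε : Fin ν → ℤˣ) (R : ℕ) (x : box ν R) :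
    ((boxSignedPerm π ε R x : box ν R) : Site ν) = Site.signedPerm π ε (x : Site ν) := rfl

omit ν in
/-- Signed coordinate permutations fix the centre of the box. [cite: Lieb1980, p. 128 (the box and its boundary B)] -/
theorem boxSignedPerm_refCentre {ν : ℕ} (π : Equiv.Perm (Fin ν)) (ε : Fin ν → ℤˣ) (R : ℕ) :
    boxSignedPerm π ε R (refCentre ν R) = refCentre ν R :=
  Subtype.ext (Site.signedPerm_zero π ε)

omit ν in
/-- Signed coordinate permutations preserve the nearest-neighbour XY couplings of the box (`ℓ¹` isometries).
[cite: Ginibre1970, Example 4 (plane rotators)] -/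
theorem nnXYCoupling_boxSignedPerm {ν : ℕ} (K : ℝ) (π : Equiv.Perm (Fin ν)) (ε : Fin ν → ℤˣ) (R : ℕ)
    (x y : box ν R) :
    nnXYCoupling K ν (box ν R) (boxSignedPerm π ε R x, boxSignedPerm π ε R y) =
      nnXYCoupling K ν (box ν R) (x, y) := by
  simp only [nnXYCoupling, boxSignedPerm_apply_coe, nnCoupling, l1Norm_signedPerm_sub]

variable [MeasurableSpace Circle] [BorelSpace Circle]

/-- **Hyperoctahedral symmetry of the free box.** The two-point function of the nearest-neighbour XY model on
`[−R, R]^ν` with free boundary conditions is invariant under every signed coordinate permutation `σ`: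
`⟨cos(θ_{σx} − θ_{σy})⟩ = ⟨cos(θ_x − θ_y)⟩`. [cite: Ginibre1970, Example 4 (plane rotators)] -/
theorem twoPoint_nnXY_box_signedPerm (K : ℝ) (π : Equiv.Perm (Fin ν)) (ε : Fin ν → ℤˣ) (R : ℕ) (x y : box ν R) :
    twoPoint (nnXYCoupling K ν (box ν R)) (boxSignedPerm π ε R x) (boxSignedPerm π ε R y) =
      twoPoint (nnXYCoupling K ν (box ν R)) x y := by
  rw [← twoPoint_comp_equiv (boxSignedPerm π ε R) (nnXYCoupling K ν (box ν R)) x y]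
  congr 1
  funext q
  exact nnXYCoupling_boxSignedPerm K π ε R q.1 q.2

/-- The centre-to-`x` two-point function of the free box depends only on the hyperoctahedral orbit of `x`:
`⟨cos(θ_0 − θ_{σx})⟩ = ⟨cos(θ_0 − θ_x)⟩`. [cite: Ginibre1970, Example 4 (plane rotators)] -/
theorem twoPoint_nnXY_box_refCentre_signedPerm (K : ℝ) (π : Equiv.Perm (Fin ν)) (ε : Fin ν → ℤˣ) (R : ℕ)
    (x : box ν R) :
    twoPoint (nnXYCoupling K ν (box ν R)) (refCentre ν R) (boxSignedPerm π ε R x) =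
      twoPoint (nnXYCoupling K ν (box ν R)) (refCentre ν R) x := by
  conv_lhs => rw [← boxSignedPerm_refCentre π ε R]
  exact twoPoint_nnXY_box_signedPerm K π ε R _ x

omit [MeasurableSpace Circle] [BorelSpace Circle] in
/-- A site of the box with ONE coordinate negated is in the box. [cite: Lieb1980, p. 128 (the box and its boundary B)] -/
theorem neg_coord_mem_box {R : ℕ} (x : box ν R) (i : Fin ν) :
    Function.update (x : Site ν) i (-(x : Site ν) i) ∈ box ν R := by
  have hx := mem_box.1 x.2
  rw [mem_box]
  intro j
  by_cases hj : j = i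
  · subst hj; rw [Function.update_self]; have := hx j; omega
  · rw [Function.update_of_ne hj]; exact hx j

/-- **Reflection symmetry**: negating one coordinate of `x` does not change `⟨cos(θ_0 − θ_x)⟩` in the free box.
[cite: Ginibre1970, Example 4 (plane rotators)] -/
theorem twoPoint_nnXY_box_refCentre_reflect (K : ℝ) {R : ℕ} (x : box ν R) (i : Fin ν) :
    twoPoint (nnXYCoupling K ν (box ν R)) (refCentre ν R)
        ⟨Function.update (x : Site ν) i (-(x : Site ν) i), neg_coord_mem_box x i⟩ =
      twoPoint (nnXYCoupling K ν (box ν R)) (refCentre ν R) x := by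
  classical
  have h := twoPoint_nnXY_box_refCentre_signedPerm K (Equiv.refl (Fin ν)) (Function.update 1 i (-1)) R x
  refine Eq.trans ?_ h
  congr 1
  apply Subtype.ext
  funext j
  simp only [boxSignedPerm_apply_coe, Site.signedPerm_apply, Equiv.refl_symm, Equiv.refl_apply]
  by_cases hj : j = i
  · subst hj; simp
  · rw [Function.update_of_ne hj, Function.update_of_ne hj]; simp

omit [MeasurableSpace Circle] [BorelSpace Circle] in
/-- A site of the box with permuted coordinates is in the box. [cite: Lieb1980, p. 128 (the box and its boundary B)] -/
theorem perm_coord_mem_box {R : ℕ} (x : box ν R) (π : Equiv.Perm (Fin ν)) :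
    (fun i => (x : Site ν) (π.symm i)) ∈ box ν R := by
  have hx := mem_box.1 x.2
  rw [mem_box]
  exact fun j => hx _

/-- **Permutation symmetry**: permuting the coordinates of `x` does not change `⟨cos(θ_0 − θ_x)⟩` in the free box.
[cite: Ginibre1970, Example 4 (plane rotators)] -/
theorem twoPoint_nnXY_box_refCentre_perm (K : ℝ) {R : ℕ} (x : box ν R) (π : Equiv.Perm (Fin ν)) :
    twoPoint (nnXYCoupling K ν (box ν R)) (refCentre ν R) ⟨fun i => (x : Site ν) (π.symm i), perm_coord_mem_box x π⟩ =
      twoPoint (nnXYCoupling K ν (box ν R)) (refCentre ν R) x := by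
  have h := twoPoint_nnXY_box_refCentre_signedPerm K π (fun _ => 1) R x
  refine Eq.trans ?_ h
  congr 1
  apply Subtype.ext
  funext j
  simp

end SignedPerm

end PlaneRotator

end Literature.Probability.LatticeModels

end
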